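import Summits.SmoothPoincare4.SmoothPoincare4.Theses.LipschitzHauptvermutung

/-!
# Birth skeleton (BC3) — crux `ClarkeRegularisation` (item `stmt-SmoothPoincare4-18749`), line `birth`

Route `route-SmoothPoincare4-LipschitzHauptvermutung` ("Lipschitz Hauptvermutung for homotopy 4-spheres,
then Clarke regularisation to a diffeomorphism"), rank-3 crux
`Summit.SmoothPoincare4.SmoothPoincare4.Theses.LipschitzHauptvermutung.ClarkeRegularisation` (K2 of the
sketch), VERBATIM the route decl:

> for every smooth homotopy 4-sphere `M` (the summit binders: `M : Type`, Hausdorff, second countable,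
> a `C^∞` atlas on `ℝ⁴`, `M ≃ₕ S⁴`): if SOME homeomorphism `h : M ≃ₜ S⁴` has `h` and `h.symm` locally
> Lipschitz in the extended charts (`LocallyLipschitzInCharts`), then some such homeomorphism is moreover
> Clarke-regular in charts in both directions (`ClarkeRegularInCharts`: at every point the Clarke
> generalised Jacobian of the chart representative is non-empty and consists of invertible maps).

THE LINE is the route header's registered two-layer plan for K2 — the SINGULAR-SET LADDER
`ClarkeRegularisation ⇐ tameToPoint → pointSingularityRemovable` — with the point-removal step stated
in the summit's own currency (`Nonempty (M ≃ₘ S⁴)`) and the return to the crux's conclusion split off as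
a separate, certainly-true formal lemma, so that every stub is ONE kind of mathematics:

* `stub_tameToPoint` (NONSMOOTH ANALYSIS — THE BET, load-bearing and hardest; size XL / open):
  a two-sidedly locally Lipschitz comparison homeomorphism `M ≃ₜ S⁴` of a smooth homotopy 4-sphere can be
  traded for one (`h`, with a point `p : M`) that is in addition Clarke-regular in charts at every
  `x ≠ p`, with `h.symm` Clarke-regular in charts at every `y ≠ h p` — "the Clarke-singular set of a
  bi-Lipschitz comparison map can be concentrated into one point".  Tools named by the route: Clarke's
  calculus of generalised Jacobians (Clarke 1976 §1, Thm. 1), upper semicontinuity and convexity of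
  `x ↦ ∂h(x)`, ε-regularity (sketch L2a), differential-inclusion rigidity (Ball–James two-well rigidity,
  Friesecke–James–Müller), compactness of `L`-bi-Lipschitz maps (extremal comparison maps exist), and the
  LIP engulfing / Alexander-cone moves that are theorems in the Lipschitz category in every dimension
  (tree, PROVED: `Literature.Geometry.Manifold.lipschitzWith_radialExt_and_leftInverse`).  It is the
  DIMENSION-FREE-COMPATIBLE half of the crux: its 7-dimensional analogue is TRUE (every homotopy 7-sphere
  is a twisted sphere, so Kondo–Tanaka 2017 Cor. 1.15 gives a bi-Lipschitz homeomorphism onto `S⁷` that is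
  a diffeomorphism — hence Clarke-regular — off one point), whereas the 7-dimensional analogue of the CRUX
  is false (Milnor spheres).  Modulo the other two stubs it is equivalent to the crux (the crux implies it
  trivially: take any `p`), which is said openly: the split isolates WHERE dimension 4 must enter (stub 2)
  from the analysis of one bounded measurable derivative field (stub 1).
* `stub_conePointStandard` (DIMENSION FOUR — isolated two-sided Clarke singularities of bi-Lipschitz
  comparison maps occur only on the standard sphere; size XL): if a smooth homotopy 4-sphere `M` carries a
  homeomorphism `h : M ≃ₜ S⁴`, two-sidedly locally Lipschitz in charts, Clarke-regular in charts off one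
  point `p` and with `h.symm` Clarke-regular off `h p`, then `M` is diffeomorphic to `S⁴`.  Route to a
  proof (prover-side, NOT items): (i) Kondo–Tanaka mollification WITHOUT compactness on the punctured
  manifolds `M ∖ {p} → S⁴ ∖ {h p}` (K–T Thm. 1.3 / Cor. 1.10 are printed for compact `M`; the method —
  local mollification, `Df_η(x)` near `∂h(x)`, composition `g_η ∘ f_η` `C⁰`-fine-close to `id` hence a
  degree-one self-covering — localises) gives `M ∖ {p} ≅ₘ ℝ⁴`, so `M = K ∪_{S³} 𝔻⁴` for a Schoenflies
  ball `K ⊂ ℝ⁴` whose cone point carries a BI-LIPSCHITZ germ `(ℝ⁴,0) → (ℝ⁴,0)` smooth off `0`; (ii) the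
  LIP-constrained case of the smooth 4-dimensional Schoenflies problem (such `K` is `𝔻⁴`; sketch L2b is
  its ε-regular sub-case), then Palais' disc theorem and Cerf's `Γ₄ = 0`.  This stub MUST use dimension 4:
  its 7-dimensional analogue is FALSE (Kondo–Tanaka Cor. 1.15 + Kervaire–Milnor: the 27 exotic 7-spheres
  carry exactly such maps), which is the route's recorded "why it might fail" for K2.  It is strictly
  weaker than the crux as a statement (the crux's hypothesis plus an isolated-singularity hypothesis; the
  crux together with the Kondo–Tanaka fact implies it) and strictly inside the smooth Schoenflies
  conjecture's shadow (implied by SPC4; no counterexample without an exotic `S⁴`).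
* `stub_diffeomorphRegular` (FORMAL, a THEOREM, size M): a `C^∞` diffeomorphism `Φ : M ≃ₘ⟮𝓡 n, 𝓡 n⟯ N`
  is, as a homeomorphism, locally Lipschitz in charts and Clarke-regular in charts, and so is its inverse:
  chart representatives of `Φ` are `C^∞` (`ContMDiffAt` read in `extChartAt`, boundaryless model so
  `range (𝓡 n) = univ`), `C¹ ⇒` locally Lipschitz (`ContDiffAt.exists_lipschitzOnWith`), and
  `∂F(x) = {DF(x)}` is invertible for a diffeomorphism (tree, PROVED: `clarkeJacobian_eq_singleton`,
  `clarkeRegularAt_of_contDiffAt`; `mfderiv` of a `Diffeomorph` is a linear equivalence).  Zero research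
  content; it is the lemma "S ⇒ K2 pointwise" that returns the line to the crux's conclusion shape, and the
  same lemma a grounder needs for the BC5 instance `M = S⁴`.

`ClarkeRegularisation_of_stubs : <stub₁-sig> → <stub₂-sig> → <stub₃-sig> → ClarkeRegularisation` is the
REAL composition (pure logic, sorry-free in itself): at `(M, e, ⟨h₀, Lip h₀, Lip h₀⁻¹⟩)`, stub 1 gives
`(h, p)` Clarke-regular off `p` / off `h p`; stub 2 gives `Φ : M ≃ₘ S⁴`; stub 3 at `n = 4, N = S⁴` shows
`Φ.toHomeomorph` is the required two-sidedly Lipschitz, two-sidedly Clarke-regular comparison map.  The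
SKELETON THEOREM (registrar shape) `ClarkeRegularisation_of : ClarkeRegularisation :=
ClarkeRegularisation_of_stubs stub_tameToPoint stub_conePointStandard stub_diffeomorphRegular` concludes the
crux BY NAME from the three declared stubs, so the hypotheses in its closure are EXACTLY the stub
statements, each by name.  `sorry` occurs ONLY in the three `stub_*` theorems.

BC3 probes (run by the registrar in `folder/bc/probe_*.lean`, each importing only this skeleton's
statements): for every stub `S`, `example : S → ClarkeRegularisation` and `example : S → SmoothPoincare4`
by the BC battery (`first | exact? | simpa | aesop`, then `exact?`, `simpa [defs]`, `unfold; simpa`,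
terminal `aesop` folded / unfolded, one `example` each, `maxHeartbeats 400000`) FAIL — 6 files × 7
probes, rc 1 everywhere, no probe closes: `S1 →`, `S3 →` crux / summit and `S2 →` summit report
"could not close the goal" / unsolved goals / aesop exhaustive-search failure; for `S2 → crux` the
`simpa` / `aesop` probes fail the same way and `exact?` exhausts 400 000 AND 4 000 000 heartbeats
(re-run, 814 s; also with `exact? using hS` after `intro`) without producing a term — a search blow-up
through `Nonempty.some` / the stub hypothesis, reported as timeout-not-proof.  Mathematically: stub 1
lacks regularity AT `p`; stub 2 needs an isolated-singularity comparison map nobody hands it and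
concludes only `Nonempty (M ≃ₘ S⁴)`, from which the crux's Clarke-regular `h` needs stub 3, absent from
the library; stub 3 needs a diffeomorphism.  Conversely (informational) the crux implies stub 1 and, with the Kondo–Tanaka fact
`KtRecognition`, stub 2; `SmoothPoincare4` implies all three.

Disproof used: none — `ledger crux ls stmt-SmoothPoincare4-18749` shows no workfiles (no `Disproof.lean`,
no `_false_without_` theorem, no `Theorems/ClarkeRegularisation/Negative/*`) at registration
(2026-08-17), and `ledger negatives --problem SmoothPoincare4` lists 0 refuted statements; so there is no
obstruction to honour and no landed Negative lemma to check the stubs against.  Load-bearing hypotheses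
honoured: the homotopy equivalence `M ≃ₕ S⁴` and dimension 4 enter stub 2 (false for `Σ⁷`); the
two-sided Lipschitz hypothesis enters stubs 1 and 2 (without `LocallyLipschitzInCharts h.symm` a
Clarke-regular-off-a-point map says nothing at the cone point: one-sided Lipschitz control can always be
arranged by a radial reparametrisation, so the LIP lever would evaporate).
Barriers (route header, technique_class LIP/QC Hauptvermutung + Clarke nonsmooth analysis):
`TopologicalBarrierFour` evaded (every stub quantifies over the smooth atlas and the Lipschitz
pseudo-group, strictly finer than TOP in dimension 4, Donaldson–Sullivan 1989 Thm. 2);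
`TwistedSphereBarrierFour` / Cerf used positively only, inside stub 2's intended proof;
`OpenAnalogueBarrierFour` respected (stub 2 recognises the CLOSED `M`; the open statement
"`M ∖ {p}` bi-Lipschitz-Clarke-regular to `ℝ⁴` ⇒ standard" is only an intermediate step about `ℝ⁴`
itself, never a claim about small exotic `ℝ⁴`'s); `GaugeSumBarrierFour`, `StableBarrierFour`,
`HCobordism(Invariant)BarrierFour` not engaged (no invariant, no stabilisation, no h-cobordism step).
-/

set_option linter.dupNamespace false
set_option linter.unusedVariables false

noncomputable section

open scoped Manifold ContDiff Topology ContinuousMap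
open Set Function

namespace Summit.SmoothPoincare4.SmoothPoincare4.Cruxes.ClarkeRegularisation.Birth

open Summit.SmoothPoincare4.SmoothPoincare4.Theses.LipschitzHauptvermutung (ClarkeRegularisation)
open Literature.Geometry.Manifold

/-! ## The three registered stubs (`sorry` lives ONLY here) -/

/-- **Stub 1 — tame the Clarke-singular set to one point (THE BET; nonsmooth analysis).**
For every smooth homotopy 4-sphere `M` (summit binders) and every witness that SOME homeomorphism
`M ≃ₜ S⁴` is locally Lipschitz in charts together with its inverse, there are a homeomorphism
`h : M ≃ₜ S⁴` and a point `p : M` such that `h` and `h.symm` are locally Lipschitz in charts, `h` is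
Clarke-regular in charts (`ClarkeRegularAt` of `writtenInExtChartAt (𝓡 4) (𝓡 4) x h` at `extChartAt (𝓡 4) x x`)
at every `x ≠ p`, and `h.symm` is Clarke-regular in charts at every `y ≠ h p`.
Why plausibly true: the 7-dimensional analogue holds (Kondo–Tanaka 2017 Cor. 1.15); naive ε-regularity is
false (logarithmic spirals have `0` in the Clarke hull) but the singular set of an EXTREMAL `L`-bi-Lipschitz
comparison map is the object the route's tools act on (Clarke 1976; Ball–James / Friesecke–James–Müller
rigidity; Arzelà–Ascoli compactness of `L`-bi-Lipschitz homeomorphisms); SPC4-shielded (no counterexample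
without an exotic `S⁴`). Why it might fail: an exotic LIP-standard `Σ⁴` all of whose bi-Lipschitz
comparison maps spin on a Cantor set. Size: XL (open).
[cite: KondoTanaka2017, Corollary 1.15] [cite: Clarke1976, §1 and Theorem 1] -/
theorem stub_tameToPoint :
    ∀ (M : Type) [TopologicalSpace M] [T2Space M] [SecondCountableTopology M]
      [ChartedSpace (EuclideanSpace ℝ (Fin 4)) M] [IsManifold (𝓡 4) ∞ M],
      ContinuousMap.HomotopyEquiv M (Metric.sphere (0 : EuclideanSpace ℝ (Fin 5)) 1) →
      (∃ h : M ≃ₜ (Metric.sphere (0 : EuclideanSpace ℝ (Fin 5)) 1),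
          LocallyLipschitzInCharts (𝓡 4) (𝓡 4) h ∧ LocallyLipschitzInCharts (𝓡 4) (𝓡 4) h.symm) →
      ∃ (h : M ≃ₜ (Metric.sphere (0 : EuclideanSpace ℝ (Fin 5)) 1)) (p : M),
        LocallyLipschitzInCharts (𝓡 4) (𝓡 4) h ∧ LocallyLipschitzInCharts (𝓡 4) (𝓡 4) h.symm ∧
        (∀ x : M, x ≠ p →
          ClarkeRegularAt (writtenInExtChartAt (𝓡 4) (𝓡 4) x h) (extChartAt (𝓡 4) x x)) ∧
        (∀ y : Metric.sphere (0 : EuclideanSpace ℝ (Fin 5)) 1, y ≠ h p →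
          ClarkeRegularAt (writtenInExtChartAt (𝓡 4) (𝓡 4) y h.symm) (extChartAt (𝓡 4) y y)) := by
  sorry

/-- **Stub 2 — an isolated two-sided Clarke singularity of a bi-Lipschitz comparison map occurs only on
the standard 4-sphere (DIMENSION FOUR).** For every smooth homotopy 4-sphere `M`, every homeomorphism
`h : M ≃ₜ S⁴` with `h`, `h.symm` locally Lipschitz in charts, and every `p : M` such that `h` is
Clarke-regular in charts at all `x ≠ p` and `h.symm` at all `y ≠ h p`, the manifold `M` is diffeomorphic
to `S⁴` (`Nonempty (M ≃ₘ⟮𝓡 4, 𝓡 4⟯ S⁴)`).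
Why plausibly true: Kondo–Tanaka mollification run on the punctured manifolds (Thm. 1.3's method without
compactness) makes `M ∖ {p} ≅ₘ ℝ⁴`, i.e. `M = K ∪_{S³} 𝔻⁴` with `K` a Schoenflies ball whose cone point
carries a bi-Lipschitz germ smooth off `0`; the LIP-constrained smooth Schoenflies problem, Palais' disc
theorem and Cerf's `Γ₄ = 0` finish. Implied by SPC4; strictly weaker than the crux (its hypothesis plus an
isolated-singularity hypothesis). Why it might fail / why dimension 4 is load-bearing: the 7-dimensional
analogue is FALSE — every exotic `S⁷` carries such a map (Kondo–Tanaka Cor. 1.15 with Kervaire–Milnor).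
Size: XL. [cite: KondoTanaka2017, Theorem 1.3, Corollary 1.10 and Corollary 1.15]
[cite: KervaireMilnorAnnals1963, §1] [cite: Cerf1968, main theorem (Γ₄ = 0)] -/
theorem stub_conePointStandard :
    ∀ (M : Type) [TopologicalSpace M] [T2Space M] [SecondCountableTopology M]
      [ChartedSpace (EuclideanSpace ℝ (Fin 4)) M] [IsManifold (𝓡 4) ∞ M],
      ContinuousMap.HomotopyEquiv M (Metric.sphere (0 : EuclideanSpace ℝ (Fin 5)) 1) →
      ∀ (h : M ≃ₜ (Metric.sphere (0 : EuclideanSpace ℝ (Fin 5)) 1)) (p : M),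
        LocallyLipschitzInCharts (𝓡 4) (𝓡 4) h → LocallyLipschitzInCharts (𝓡 4) (𝓡 4) h.symm →
        (∀ x : M, x ≠ p →
          ClarkeRegularAt (writtenInExtChartAt (𝓡 4) (𝓡 4) x h) (extChartAt (𝓡 4) x x)) →
        (∀ y : Metric.sphere (0 : EuclideanSpace ℝ (Fin 5)) 1, y ≠ h p →
          ClarkeRegularAt (writtenInExtChartAt (𝓡 4) (𝓡 4) y h.symm) (extChartAt (𝓡 4) y y)) →
        Nonempty (M ≃ₘ⟮𝓡 4, 𝓡 4⟯ (Metric.sphere (0 : EuclideanSpace ℝ (Fin 5)) 1)) := by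
  sorry

/-- **Stub 3 — a diffeomorphism is bi-Lipschitz and two-sidedly Clarke-regular in charts (FORMAL; a
theorem).** For manifolds `M`, `N` modelled on `ℝⁿ` (`IsManifold (𝓡 n) ∞`) and a `C^∞` diffeomorphism
`Φ : M ≃ₘ⟮𝓡 n, 𝓡 n⟯ N`, the homeomorphism `Φ.toHomeomorph` and its inverse are locally Lipschitz in charts
and Clarke-regular in charts: chart representatives are `C^∞` with invertible derivative, `C¹` maps are
locally Lipschitz (`ContDiffAt.exists_lipschitzOnWith`) and `∂F(x) = {DF(x)}` (tree:
`clarkeJacobian_eq_singleton`, `clarkeRegularAt_of_contDiffAt`). Why plausibly true: it is a theorem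
(Clarke 1976 §1, Remark; Kondo–Tanaka 2017 §2). Size: M (formal: `mfderiv` of a `Diffeomorph` is
invertible and equals the `fderiv` of the chart representative on `range (𝓡 n) = univ`).
[cite: Clarke1976, §1] [cite: KondoTanaka2017, §2] -/
theorem stub_diffeomorphRegular :
    ∀ (n : ℕ) (M : Type) [TopologicalSpace M] [ChartedSpace (EuclideanSpace ℝ (Fin n)) M]
      [IsManifold (𝓡 n) ∞ M] (N : Type) [TopologicalSpace N]
      [ChartedSpace (EuclideanSpace ℝ (Fin n)) N] [IsManifold (𝓡 n) ∞ N]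
      (Φ : M ≃ₘ⟮𝓡 n, 𝓡 n⟯ N),
      LocallyLipschitzInCharts (𝓡 n) (𝓡 n) Φ.toHomeomorph ∧
        LocallyLipschitzInCharts (𝓡 n) (𝓡 n) Φ.toHomeomorph.symm ∧
        ClarkeRegularInCharts (𝓡 n) (𝓡 n) Φ.toHomeomorph ∧
        ClarkeRegularInCharts (𝓡 n) (𝓡 n) Φ.toHomeomorph.symm := by
  sorry

/-! ## The composition (kernel-checked, sorry-free): stubs ⟹ crux BY NAME -/

/-- **Assembly (kernel-checked, no `sorry`) — the three stub STATEMENTS imply `ClarkeRegularisation`.**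
Given the binders of the crux (`M`, `e : M ≃ₕ S⁴`, a witness of two-sided Lipschitz standardness):
stub 1 concentrates the singular set into one point, stub 2 recognises `M ≅ₘ S⁴`, stub 3 reads the
diffeomorphism as the required comparison map. Pure logic. [cite: KondoTanaka2017, Corollary 1.10 and Corollary 1.15] -/
theorem ClarkeRegularisation_of_stubs :
    (∀ (M : Type) [TopologicalSpace M] [T2Space M] [SecondCountableTopology M]
      [ChartedSpace (EuclideanSpace ℝ (Fin 4)) M] [IsManifold (𝓡 4) ∞ M],
      ContinuousMap.HomotopyEquiv M (Metric.sphere (0 : EuclideanSpace ℝ (Fin 5)) 1) →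
      (∃ h : M ≃ₜ (Metric.sphere (0 : EuclideanSpace ℝ (Fin 5)) 1),
          LocallyLipschitzInCharts (𝓡 4) (𝓡 4) h ∧ LocallyLipschitzInCharts (𝓡 4) (𝓡 4) h.symm) →
      ∃ (h : M ≃ₜ (Metric.sphere (0 : EuclideanSpace ℝ (Fin 5)) 1)) (p : M),
        LocallyLipschitzInCharts (𝓡 4) (𝓡 4) h ∧ LocallyLipschitzInCharts (𝓡 4) (𝓡 4) h.symm ∧
        (∀ x : M, x ≠ p →
          ClarkeRegularAt (writtenInExtChartAt (𝓡 4) (𝓡 4) x h) (extChartAt (𝓡 4) x x)) ∧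
        (∀ y : Metric.sphere (0 : EuclideanSpace ℝ (Fin 5)) 1, y ≠ h p →
          ClarkeRegularAt (writtenInExtChartAt (𝓡 4) (𝓡 4) y h.symm) (extChartAt (𝓡 4) y y))) →
    (∀ (M : Type) [TopologicalSpace M] [T2Space M] [SecondCountableTopology M]
      [ChartedSpace (EuclideanSpace ℝ (Fin 4)) M] [IsManifold (𝓡 4) ∞ M],
      ContinuousMap.HomotopyEquiv M (Metric.sphere (0 : EuclideanSpace ℝ (Fin 5)) 1) →
      ∀ (h : M ≃ₜ (Metric.sphere (0 : EuclideanSpace ℝ (Fin 5)) 1)) (p : M),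
        LocallyLipschitzInCharts (𝓡 4) (𝓡 4) h → LocallyLipschitzInCharts (𝓡 4) (𝓡 4) h.symm →
        (∀ x : M, x ≠ p →
          ClarkeRegularAt (writtenInExtChartAt (𝓡 4) (𝓡 4) x h) (extChartAt (𝓡 4) x x)) →
        (∀ y : Metric.sphere (0 : EuclideanSpace ℝ (Fin 5)) 1, y ≠ h p →
          ClarkeRegularAt (writtenInExtChartAt (𝓡 4) (𝓡 4) y h.symm) (extChartAt (𝓡 4) y y)) →
        Nonempty (M ≃ₘ⟮𝓡 4, 𝓡 4⟯ (Metric.sphere (0 : EuclideanSpace ℝ (Fin 5)) 1))) →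
    (∀ (n : ℕ) (M : Type) [TopologicalSpace M] [ChartedSpace (EuclideanSpace ℝ (Fin n)) M]
      [IsManifold (𝓡 n) ∞ M] (N : Type) [TopologicalSpace N]
      [ChartedSpace (EuclideanSpace ℝ (Fin n)) N] [IsManifold (𝓡 n) ∞ N]
      (Φ : M ≃ₘ⟮𝓡 n, 𝓡 n⟯ N),
      LocallyLipschitzInCharts (𝓡 n) (𝓡 n) Φ.toHomeomorph ∧
        LocallyLipschitzInCharts (𝓡 n) (𝓡 n) Φ.toHomeomorph.symm ∧
        ClarkeRegularInCharts (𝓡 n) (𝓡 n) Φ.toHomeomorph ∧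
        ClarkeRegularInCharts (𝓡 n) (𝓡 n) Φ.toHomeomorph.symm) →
    ClarkeRegularisation := by
  intro h₁ h₂ h₃ M _ _ _ _ _ e hLip
  -- stub 1: a comparison map Clarke-regular off one point (two-sidedly Lipschitz everywhere)
  obtain ⟨h, p, hL, hL', hC, hC'⟩ := h₁ M e hLip
  -- stub 2: such an `M` is diffeomorphic to `S⁴`
  obtain ⟨Φ⟩ := h₂ M e h p hL hL' hC hC'
  -- stub 3: the diffeomorphism is the required bi-Lipschitz Clarke-regular comparison map
  obtain ⟨a, b, c, d⟩ := h₃ 4 M (Metric.sphere (0 : EuclideanSpace ℝ (Fin 5)) 1) Φ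
  exact ⟨Φ.toHomeomorph, a, b, c, d⟩

/-- **THE SKELETON THEOREM (registrar shape).** The crux
`Summit.SmoothPoincare4.SmoothPoincare4.Theses.LipschitzHauptvermutung.ClarkeRegularisation`, concluded BY
NAME from the three declared stubs through the sorry-free assembly `ClarkeRegularisation_of_stubs`; the
only `sorry`s in its closure are `stub_tameToPoint`, `stub_conePointStandard`, `stub_diffeomorphRegular`. -/
theorem ClarkeRegularisation_of : ClarkeRegularisation :=
  ClarkeRegularisation_of_stubs stub_tameToPoint stub_conePointStandard stub_diffeomorphRegular

end Summit.SmoothPoincare4.SmoothPoincare4.Cruxes.ClarkeRegularisation.Birth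

end
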